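import Literature.NumberTheory.EllipticCurves.SingularModuliWeberCubeRoot
import Literature.NumberTheory.EllipticCurves.HeegnerPointsLevelTransportOrders
import Literature.NumberTheory.EllipticCurves.KleinJRealValues
import HarnessLib

/-!
# Singular moduli of discriminant `d_K ≡ 2 (mod 3)` are cubes in the field of singular moduli
# (Cox, *Primes of the form x² + ny²*, Thm. 12.2 — the case `3` inert in `K`, by Cox's degree argument)

Topic `NumberTheory/EllipticCurves` (complex multiplication), namespace
`Literature.NumberTheory.EllipticCurves`.  Theorems only (no definition, no named fact).

`SingularModuliWeberCubeRoot.lean` proves the cube statement of Cox's Thm. 12.2 ("`3 ∤ D` …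
`K(γ₂(τ₀))` is the ring class field", so `j(τ₀) = γ₂(τ₀)³` is a cube in `H = K(j(τ₀))`) for the
maximal order when `3` *splits* in `K`, through the level-`9` Heegner points of discriminant `d_K`.
When `3` is *inert* (`d_K ≡ 2 (mod 3)`) there are no such points, and this file follows Cox's own
proof (pp. 260–261) at the CM point `P₀ = τ₀/3` of the **order of conductor `3`**:

* `τ₀ = τ_{(1, 3b, c)}` (`b = 0`: `τ₀ = √−m`; `b = −1`: `τ₀ = (3 + √−m)/2`), `P₀ = τ₀/3 = τ_{(9, 9b, c)}`,
  a primitive form of discriminant `9d_K` with `gcd(9, c) = 1` (`3 ∤ c` as `3 ∤ d_K`);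
* (transport, `HeegnerPointsLevelTransportOrders`) every `σ ∈ Aut(ℂ)` fixing `√d_K` and
  `x := j(P₀)` fixes `g := γ₂(τ₀) = u₉(P₀)` (`u₉ = γ₂(3τ) ∈ ℚ(X₀(9))`, `mapLaurent_weberNineFn`);
  since `x` and `g` are **real** (`KleinJRealValues`; Cox: "`γ₂(τ₀)` is the real cube root of
  `j(τ₀)`"), composing with complex conjugation removes the condition on `√d_K`, so
  `g ∈ F := ℚ(x)` (`weberNineValue_mem_adjoin`: the fixed field of `Aut(ℂ/ℚ(x))` is `ℚ(x)`);
* (degrees, replacing Cox's count `[L′ : L] = h(9D)/h(D) ∈ {2, 4}` by Thm. 7.24, which the tree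
  does not have; `exists_mem_adjoin_pow_three_eq`) with `E := ℚ(y)`, `y = j(τ₀) = g³ ∈ F`:
  `r := [E(x) : E] ≤ 4` because `x` is a root of `Φ₃(X, y) ∈ E[X]`
  (`modularPolynomial_kleinJ_divPoint`), and `r ≠ 3`: otherwise the linear cofactor has a root in
  `E`, which is one of the four roots `j(3τ₀)`, `j((τ₀ + k)/3)` — all singular moduli of
  *primitive* forms of discriminant `9d_K` (this is where `3` inert is used), hence of the same
  degree over `ℚ` as `x` (`minpoly_formJ_eq_principalForm`); that degree would both divide and be
  a multiple of `[E : ℚ]`, forcing `x ∈ E`, `r = 1`.  So `r ∈ {1, 2, 4}`, and `s := [E(g) : E]`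
  divides `r` and is `≤ 3` (`g³ = y`), so `s ∈ {1, 2}`: either `g ∈ E`, or `X³ − y` has a linear
  factor over `E`.  In both cases **`j(τ₀)` has a cube root in `ℚ(j(τ₀)) ⊆ H_K`**;
* conjugation to all singular moduli of discriminant `d_K` (`exists_mem_pow_three_eq_formJ_of_one`
  of the split file) and the ideal form.

Main results: `exists_mem_singularModuliField_pow_three_eq_formJ_of_inert`,
`exists_span_formJ_eq_pow_three_of_inert`, and, with the split case,
`exists_span_formJ_eq_pow_three_of_not_dvd` — **Cox's Thm. 12.2 (cube part, maximal order,
`3 ∤ d_K`): `(j(τ_{Q₀})) = (w)³` in `𝓞 H_K`**.  Not covered: `3 ∣ d_K` (Cox Thm. 12.13: then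
`[K(γ₂(τ₀)) : H] = 3`).  Groundwork for the CM input (C) of
`Literature.Barriers.ABC.OWeakUniformABCImpliesNoSiegelZeros`.

## References

* D. A. Cox, *Primes of the form x² + ny²*, 2nd ed., 2013, §12.A Thm. 12.2 and its proof
  (pp. 260–262), Prop. 12.3, §11.B (11.15). [Cox2013]
* G. Shimura, *Introduction to the arithmetic theory of automorphic functions*, 1971, §6.8.
  [ShimuraIATAF1971]
* B. H. Gross, *Heegner points on X₀(N)*, 1984, §I.1. [Gross1984]
-/

noncomputable section

open Complex Polynomial NumberField
open UpperHalfPlane hiding I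
open scoped MatrixGroups ModularForm Cardinal IntermediateField ComplexConjugate

universe u

namespace Literature.NumberTheory.EllipticCurves

open ModularForms Literature.FieldTheory.AlgClosed
open Literature.NumberTheory.QuadraticFields.BinaryQuadraticForm
open Literature.NumberTheory.QuadraticFields.Quadratic (discr_emod_four)

/-! ### Coordinates: `√(9D) = 3√D`, `τ_Q = (√D − B)/2A`, the points `3τ₀`, `(τ₀ + k)/3` -/

/-- `√(9D) = 3√D`. [folklore] -/
theorem sqrtDisc_nine_mul (D : ℤ) : sqrtDisc (9 * D) = 3 * sqrtDisc D := by
  have h9 : Real.sqrt 9 = 3 := by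
    rw [show (9 : ℝ) = 3 ^ 2 by norm_num, Real.sqrt_sq (by norm_num)]
  have h : Real.sqrt (-((9 * D : ℤ) : ℝ)) = 3 * Real.sqrt (-(D : ℝ)) := by
    push_cast
    rw [show -(9 * (D : ℝ)) = 9 * (-(D : ℝ)) by ring, Real.sqrt_mul (by norm_num), h9]
  rw [sqrtDisc, sqrtDisc, h]
  push_cast
  ring

/-- `conj √D = −√D`. [folklore] -/
theorem conj_sqrtDisc (D : ℤ) : conj (sqrtDisc D) = -sqrtDisc D := by
  rw [sqrtDisc, map_mul, Complex.conj_I, Complex.conj_ofReal]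
  ring

/-- `Re √D = 0`. [folklore] -/
theorem sqrtDisc_re (D : ℤ) : (sqrtDisc D).re = 0 := by
  simp [sqrtDisc]

/-- An automorphism of `ℂ` maps `√D` to `±√D` (`D < 0`). [folklore] -/
theorem ringEquiv_apply_sqrtDisc {D : ℤ} (hD : D < 0) (σ : ℂ ≃+* ℂ) :
    σ (sqrtDisc D) = sqrtDisc D ∨ σ (sqrtDisc D) = -sqrtDisc D := by
  apply sq_eq_sq_iff_eq_or_eq_neg.mp
  rw [← map_pow, sqrtDisc_sq hD, map_intCast]

/-- **`τ_Q = (√D − B)/(2A)`** as a complex number, for a positive definite form of discriminant `D`.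
[folklore] -/
theorem coe_heegnerTau_eq {D : ℤ} {Q : ℤ × ℤ × ℤ} (hA : 0 < Q.1)
    (hdisc : Q.2.1 ^ 2 - 4 * Q.1 * Q.2.2 = D) (hD : D < 0) :
    (heegnerTau Q : ℂ) = (sqrtDisc D - Q.2.1) / (2 * Q.1) := by
  have h := sqrtDisc_eq hA hdisc hD
  have hA0 : (Q.1 : ℂ) ≠ 0 := by exact_mod_cast hA.ne'
  rw [h]
  field_simp
  ring

section Points

variable {b c : ℤ}

/-- `3τ₀ = τ_{(1, 9b, 9c)}` for `τ₀ = τ_{(1, 3b, c)}`. [folklore] -/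
theorem mulPoint_three_heegnerTau (hD : 9 * b ^ 2 - 4 * c < 0) :
    mulPoint 3 (heegnerTau (1, 3 * b, c)) = heegnerTau (1, 9 * b, 9 * c) := by
  apply UpperHalfPlane.ext
  rw [coe_mulPoint, coe_heegnerTau_eq (Q := (1, 3 * b, c)) (D := 9 * b ^ 2 - 4 * c) one_pos
      (by push_cast; ring) hD,
    coe_heegnerTau_eq (Q := (1, 9 * b, 9 * c)) (D := 9 * (9 * b ^ 2 - 4 * c)) one_pos
      (by push_cast; ring) (by linarith), sqrtDisc_nine_mul]
  push_cast
  ring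

/-- `(τ₀ + k)/3 = τ_{(9, 9b − 6k, k² − 3bk + c)}` for `τ₀ = τ_{(1, 3b, c)}`. [folklore] -/
theorem divPoint_three_heegnerTau (hD : 9 * b ^ 2 - 4 * c < 0) (k : ℤ) :
    divPoint 3 k (heegnerTau (1, 3 * b, c)) =
      heegnerTau (9, 9 * b - 6 * k, k ^ 2 - 3 * b * k + c) := by
  apply UpperHalfPlane.ext
  rw [coe_divPoint, coe_heegnerTau_eq (Q := (1, 3 * b, c)) (D := 9 * b ^ 2 - 4 * c) one_pos
      (by push_cast; ring) hD,
    coe_heegnerTau_eq (Q := (9, 9 * b - 6 * k, k ^ 2 - 3 * b * k + c))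
      (D := 9 * (9 * b ^ 2 - 4 * c)) (by norm_num) (by push_cast; ring) (by linarith),
    sqrtDisc_nine_mul]
  push_cast
  ring

/-- `τ₀/3 = τ_{(9, 9b, c)}`: the CM point `P₀` of the order of conductor `3` (Cox: "`[1, τ₀/3]` is a
proper fractional `𝒪′`-ideal"). [cite: Cox2013, §12.A proof of Thm. 12.2] -/
theorem divPoint_three_zero_heegnerTau (hD : 9 * b ^ 2 - 4 * c < 0) :
    divPoint 3 0 (heegnerTau (1, 3 * b, c)) = heegnerTau (9, 9 * b, c) := by
  rw [divPoint_three_heegnerTau hD 0]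
  norm_num

/-- `3 · P₀ = τ₀`: `tpD 3 • τ_{(9, 9b, c)} = τ_{(1, 3b, c)}`. [folklore] -/
theorem tpD_three_smul_heegnerTau (hD : 9 * b ^ 2 - 4 * c < 0) :
    tpD 3 • heegnerTau (9, 9 * b, c) = heegnerTau (1, 3 * b, c) := by
  apply UpperHalfPlane.ext
  rw [coe_tpD_smul, coe_heegnerTau_eq (Q := (1, 3 * b, c)) (D := 9 * b ^ 2 - 4 * c) one_pos
      (by push_cast; ring) hD,
    coe_heegnerTau_eq (Q := (9, 9 * b, c)) (D := 9 * (9 * b ^ 2 - 4 * c)) (by norm_num)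
      (by push_cast; ring) (by linarith), sqrtDisc_nine_mul]
  push_cast
  ring

/-- `2 Re τ₀ = −3b` for `τ₀ = τ_{(1, 3b, c)}`. [folklore] -/
theorem two_mul_re_heegnerTau_one (hD : 9 * b ^ 2 - 4 * c < 0) :
    2 * (heegnerTau (1, 3 * b, c)).re = 3 * ((-b : ℤ) : ℝ) := by
  rw [← UpperHalfPlane.coe_re, coe_heegnerTau_eq (Q := (1, 3 * b, c)) (D := 9 * b ^ 2 - 4 * c)
    one_pos (by push_cast; ring) hD]
  have := sqrtDisc_re (9 * b ^ 2 - 4 * c)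
  simp only [Complex.div_re, Complex.sub_re, this, Complex.sub_im, normSq_apply] at *
  push_cast
  simp
  ring

/-- `2 Re P₀ = −b` for `P₀ = τ_{(9, 9b, c)}`. [folklore] -/
theorem two_mul_re_heegnerTau_nine (hD : 9 * b ^ 2 - 4 * c < 0) :
    2 * (heegnerTau (9, 9 * b, c)).re = ((-b : ℤ) : ℝ) := by
  rw [← UpperHalfPlane.coe_re, coe_heegnerTau_eq (Q := (9, 9 * b, c))
    (D := 9 * (9 * b ^ 2 - 4 * c)) (by norm_num) (by push_cast; ring) (by linarith)]
  have := sqrtDisc_re (9 * (9 * b ^ 2 - 4 * c))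
  simp only [Complex.div_re, Complex.sub_re, this] at *
  push_cast
  simp
  ring

end Points

/-! ### The forms of discriminant `9D`: `(9, 9b, c)`, `(1, 9b, 9c)`, `(9, 9b − 6k, k² − 3bk + c)` -/

section Forms

variable {b c : ℤ}

/-- A form `(A, B, C)` with `gcd(A, C) = 1` is primitive. [folklore] -/
theorem isPrimitive_of_isCoprime {A B C : ℤ} (h : IsCoprime A C) : IsPrimitive (A, B, C) := by
  rw [isPrimitive_iff_binQF,
    _root_.Literature.NumberTheory.QuadraticFields.Quadratic.BinQF.isPrimitive_iff]
  intro d hdA _ hdC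
  exact h.isUnit_of_dvd' hdA hdC

/-- `gcd(9, c) = 1` when `3 ∤ c`. [folklore] -/
theorem isCoprime_nine_of_not_dvd (hc : ¬ (3 : ℤ) ∣ c) : IsCoprime (9 : ℤ) c := by
  have h : IsCoprime (3 : ℤ) c := (Int.prime_three.coprime_iff_not_dvd).mpr hc
  simpa using h.pow_left (m := 2)

/-- In the inert case `c ≡ 1 (mod 3)`, none of `k² − 3bk + c` is divisible by `3`
(`k² + 1 ≢ 0 (mod 3)`): the four lattices of index `3` in `[1, τ₀]` all have multiplier ring the
order of conductor `3`. [cite: Cox2013, §12.A proof of Thm. 12.2] -/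
theorem not_three_dvd_conjCoeff (hc : c % 3 = 1) (k : ℤ) : ¬ (3 : ℤ) ∣ k ^ 2 - 3 * b * k + c := by
  intro h
  have h0 : ((k ^ 2 - 3 * b * k + c : ℤ) : ZMod 3) = 0 :=
    (ZMod.intCast_zmod_eq_zero_iff_dvd _ 3).mpr (by exact_mod_cast h)
  have hc' : ((c : ℤ) : ZMod 3) = 1 := by
    have h := ZMod.intCast_mod c 3
    rw [show c % ((3 : ℕ) : ℤ) = 1 from hc] at h
    simpa using h.symm
  have h3 : ((3 : ℤ) : ZMod 3) = 0 := by decide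
  push_cast at h0
  rw [hc', show (3 : ZMod 3) = 0 from h3] at h0
  have key : ∀ t : ZMod 3, t ^ 2 - 0 * (b : ZMod 3) * t + 1 ≠ 0 := by
    intro t; generalize (b : ZMod 3) = s; revert t s; decide
  exact key _ h0

/-- `3 ∤ c` when `c ≡ 1 (mod 3)`. [folklore] -/
theorem not_three_dvd_of_emod (hc : c % 3 = 1) : ¬ (3 : ℤ) ∣ c := by
  intro h; omega

/-- `(9, 9b, c) ∈ heegnerForms 9 (9D)` for `D = 9b² − 4c`, `3 ∤ c`: the CM point `τ₀/3` of level `9`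
for the order of conductor `3`. [cite: Cox2013, §12.A proof of Thm. 12.2] -/
theorem nine_mem_heegnerForms (hc : ¬ (3 : ℤ) ∣ c) :
    ((9 : ℤ), 9 * b, c) ∈ heegnerForms 9 (9 * (9 * b ^ 2 - 4 * c)) := by
  refine ⟨by push_cast; ring, by norm_num, by norm_num, ?_⟩
  intro d hdA _ hdC
  exact (isCoprime_nine_of_not_dvd hc).isUnit_of_dvd' hdA hdC

/-- `(9, 9b, c)` is primitive of discriminant `9D`. [folklore] -/
theorem nine_spec (hc : ¬ (3 : ℤ) ∣ c) :
    0 < ((9 : ℤ), 9 * b, c).1 ∧ IsPrimitive ((9 : ℤ), 9 * b, c) ∧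
      discr ((9 : ℤ), 9 * b, c) = 9 * (9 * b ^ 2 - 4 * c) := by
  refine ⟨by norm_num, isPrimitive_of_isCoprime (isCoprime_nine_of_not_dvd hc), ?_⟩
  rw [QuadraticFields.BinaryQuadraticForm.discr_apply]; ring

/-- `(1, 9b, 9c)` is primitive of discriminant `9D`. [folklore] -/
theorem one_nine_spec (b c : ℤ) :
    0 < ((1 : ℤ), 9 * b, 9 * c).1 ∧ IsPrimitive ((1 : ℤ), 9 * b, 9 * c) ∧
      discr ((1 : ℤ), 9 * b, 9 * c) = 9 * (9 * b ^ 2 - 4 * c) := by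
  refine ⟨by norm_num, isPrimitive_one _ _, ?_⟩
  rw [QuadraticFields.BinaryQuadraticForm.discr_apply]; ring

/-- `(9, 9b − 6k, k² − 3bk + c)` is primitive of discriminant `9D` when `c ≡ 1 (mod 3)`. [folklore] -/
theorem nine_conj_spec (hc : c % 3 = 1) (k : ℤ) :
    0 < ((9 : ℤ), 9 * b - 6 * k, k ^ 2 - 3 * b * k + c).1 ∧
      IsPrimitive ((9 : ℤ), 9 * b - 6 * k, k ^ 2 - 3 * b * k + c) ∧
      discr ((9 : ℤ), 9 * b - 6 * k, k ^ 2 - 3 * b * k + c) = 9 * (9 * b ^ 2 - 4 * c) := by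
  refine ⟨by norm_num,
    isPrimitive_of_isCoprime (isCoprime_nine_of_not_dvd (not_three_dvd_conjCoeff hc k)), ?_⟩
  rw [QuadraticFields.BinaryQuadraticForm.discr_apply]; ring

/-- `(1, 3b, c)` is primitive of discriminant `D = 9b² − 4c`. [folklore] -/
theorem one_three_spec (b c : ℤ) :
    0 < ((1 : ℤ), 3 * b, c).1 ∧ IsPrimitive ((1 : ℤ), 3 * b, c) ∧
      discr ((1 : ℤ), 3 * b, c) = 9 * b ^ 2 - 4 * c := by
  refine ⟨by norm_num, isPrimitive_one _ _, ?_⟩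
  rw [QuadraticFields.BinaryQuadraticForm.discr_apply]; ring

end Forms

/-! ### `j(P₀)` and `γ₂(τ₀) = u₉(P₀)` are real -/

section Real

variable {b c : ℤ}

/-- `x = j(P₀) = j(τ_{(9, 9b, c)})` is real (`2 Re P₀ = −b ∈ ℤ`). [cite: Cox2013, §12.A proof of Thm. 12.2 (p. 261)] -/
theorem conj_formJ_nine (hD : 9 * b ^ 2 - 4 * c < 0) :
    conj (formJ ((9 : ℤ), 9 * b, c)) = formJ ((9 : ℤ), 9 * b, c) := by
  rw [Complex.conj_eq_iff_im, formJ_eq_kleinJ]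
  exact kleinJ_im_eq_zero _ (k := -b) (two_mul_re_heegnerTau_nine hD)

/-- `(tpD 3 • τ : ℂ) = 3τ`. [folklore] -/
theorem coe_tpD_three_smul (τ : ℍ) : ((tpD 3 • τ : ℍ) : ℂ) = 3 * (τ : ℂ) := by
  rw [coe_tpD_smul, Nat.cast_ofNat]

/-- **`g = γ₂(τ₀) = u₉(P₀)` is real** ("the real cube root of `j(τ₀)`"): `2 Re τ₀ = −3b ∈ 3ℤ`.
[cite: Cox2013, §12.A proof of Thm. 12.2 (p. 261)] -/
theorem conj_weberNineValue_nine (hD : 9 * b ^ 2 - 4 * c < 0) :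
    conj (weberNineValue (heegnerTau ((9 : ℤ), 9 * b, c))) =
      weberNineValue (heegnerTau ((9 : ℤ), 9 * b, c)) := by
  rw [Complex.conj_eq_iff_im, weberNineValue, ← coe_tpD_three_smul, tpD_three_smul_heegnerTau hD]
  exact E₄_div_eta_pow_eight_im_eq_zero _ (k := -b) (two_mul_re_heegnerTau_one hD)

/-- `g³ = y`: `u₉(P₀)³ = j(3P₀) = j(τ₀)`. [cite: Cox2013, §12.A (`γ₂³ = j`)] -/
theorem weberNineValue_nine_pow_three (hD : 9 * b ^ 2 - 4 * c < 0) :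
    weberNineValue (heegnerTau ((9 : ℤ), 9 * b, c)) ^ 3 = formJ ((1 : ℤ), 3 * b, c) := by
  rw [weberNineValue_pow_three, tpD_three_smul_heegnerTau hD, formJ_eq_kleinJ]

end Real

/-! ### Transport: `Aut(ℂ/ℚ(j(P₀)))` fixes `γ₂(τ₀)` -/

section Transport

variable {b c : ℤ}

/-- An automorphism of `ℂ` fixing `√D` and `j(P₀)` fixes `γ₂(τ₀) = u₉(P₀)`: level-`9` transport at
the CM point `P₀ = τ_{(9, 9b, c)}` of the order of conductor `3`
(`levelTransport_self_of_apply_formJ_eq_of_fst_eq`, `gcd(9, c) = 1`) and `Aut(ℂ)`-invariance of the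
`q`-series of `u₉ = γ₂(3τ)` (`mapLaurent_weberNineFn`). [cite: Cox2013, §12.A proof of Thm. 12.2 ((12.10))] -/
theorem apply_weberNineValue_nine_eq_of_sqrtDisc (hD : 9 * b ^ 2 - 4 * c < 0) (hc : ¬ (3 : ℤ) ∣ c)
    {σ : ℂ ≃+* ℂ} (hσ : σ (sqrtDisc (9 * b ^ 2 - 4 * c)) = sqrtDisc (9 * b ^ 2 - 4 * c))
    (hx : σ (formJ ((9 : ℤ), 9 * b, c)) = formJ ((9 : ℤ), 9 * b, c)) :
    σ (weberNineValue (heegnerTau ((9 : ℤ), 9 * b, c))) =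
      weberNineValue (heegnerTau ((9 : ℤ), 9 * b, c)) := by
  have hσ9 : σ (sqrtDisc (9 * (9 * b ^ 2 - 4 * c))) = sqrtDisc (9 * (9 * b ^ 2 - 4 * c)) := by
    rw [sqrtDisc_nine_mul, map_mul, map_ofNat, hσ]
  have hT := levelTransport_self_of_apply_formJ_eq_of_fst_eq (N := 9) (by linarith)
    (nine_mem_heegnerForms hc) rfl (isCoprime_nine_of_not_dvd hc) hσ9 hx
  exact LevelTransport.apply_value_eq (N := 9) hT (mapLaurent_weberNineFn (σ : ℂ →+* ℂ))
    (pointValuation_weberNineFn_sub_lt_one _)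

/-- **An automorphism of `ℂ` fixing `j(P₀)` fixes `γ₂(τ₀)`** — no condition on `√D`: if
`σ(√D) = −√D`, apply the previous statement to `σ ∘ conj`, using that `j(P₀)` and `γ₂(τ₀)` are real.
[cite: Cox2013, §12.A proof of Thm. 12.2 (p. 261)] -/
theorem apply_weberNineValue_nine_eq (hD : 9 * b ^ 2 - 4 * c < 0) (hc : ¬ (3 : ℤ) ∣ c)
    {σ : ℂ ≃+* ℂ} (hx : σ (formJ ((9 : ℤ), 9 * b, c)) = formJ ((9 : ℤ), 9 * b, c)) :
    σ (weberNineValue (heegnerTau ((9 : ℤ), 9 * b, c))) =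
      weberNineValue (heegnerTau ((9 : ℤ), 9 * b, c)) := by
  rcases ringEquiv_apply_sqrtDisc hD σ with h | h
  · exact apply_weberNineValue_nine_eq_of_sqrtDisc hD hc h hx
  · set σ' : ℂ ≃+* ℂ := (starRingAut : ℂ ≃+* ℂ).trans σ with hσ'
    have h1 : σ' (sqrtDisc (9 * b ^ 2 - 4 * c)) = sqrtDisc (9 * b ^ 2 - 4 * c) := by
      rw [hσ', RingEquiv.coe_trans, Function.comp_apply, starRingAut_apply, Complex.star_def,
        conj_sqrtDisc, map_neg, h, neg_neg]
    have h2 : σ' (formJ ((9 : ℤ), 9 * b, c)) = formJ ((9 : ℤ), 9 * b, c) := by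
      rw [hσ', RingEquiv.coe_trans, Function.comp_apply, starRingAut_apply, Complex.star_def,
        conj_formJ_nine hD, hx]
    have h3 := apply_weberNineValue_nine_eq_of_sqrtDisc hD hc h1 h2
    rwa [hσ', RingEquiv.coe_trans, Function.comp_apply, starRingAut_apply, Complex.star_def,
      conj_weberNineValue_nine hD] at h3

/-- **`γ₂(τ₀) ∈ ℚ(j(P₀))`** (Cox (12.10): "`γ₂(τ₀) ∈ ℚ(j([1, τ₀/3]), j([1, 3τ₀]))`", here sharpened by
realness): the fixed field of `Aut(ℂ/ℚ(j(P₀)))` is `ℚ(j(P₀))` (`Complex.mem_subfield_of_forall_ringEquiv`).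
[cite: Cox2013, §12.A proof of Thm. 12.2 ((12.10))] -/
theorem weberNineValue_nine_mem_adjoin (hD : 9 * b ^ 2 - 4 * c < 0) (hc : ¬ (3 : ℤ) ∣ c) :
    weberNineValue (heegnerTau ((9 : ℤ), 9 * b, c)) ∈ ℚ⟮formJ ((9 : ℤ), 9 * b, c)⟯ := by
  set x := formJ ((9 : ℤ), 9 * b, c) with hxdef
  have hcount : #(Subfield.closure ({x} : Set ℂ)) ≤ ℵ₀ :=
    (Subfield.cardinalMk_closure_le_max _).trans (by simp)
  have hmem : weberNineValue (heegnerTau ((9 : ℤ), 9 * b, c)) ∈ Subfield.closure ({x} : Set ℂ) :=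
    Complex.mem_subfield_of_forall_ringEquiv _ hcount fun σ hσ ↦
      apply_weberNineValue_nine_eq hD hc (hσ x (Subfield.subset_closure rfl))
  have hle : Subfield.closure ({x} : Set ℂ) ≤ (ℚ⟮x⟯).toSubfield := by
    rw [Subfield.closure_le, IntermediateField.coe_toSubfield, Set.singleton_subset_iff]
    exact IntermediateField.mem_adjoin_simple_self ℚ x
  exact hle hmem

end Transport

/-! ### The degree argument (Cox, p. 261, with `Φ₃` in place of the class number formula) -/

section Degrees

open IntermediateField

/-- Two singular moduli of primitive positive definite forms of the same discriminant have the same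
degree over `ℚ` (they have the same minimal polynomial, `minpoly_formJ_eq_principalForm`).
[cite: Cox2013, §13.A Prop. 13.2] -/
theorem natDegree_minpoly_formJ_eq {D : ℤ} (hD : D < 0) {Q Q' : ℤ × ℤ × ℤ}
    (hA : 0 < Q.1) (hprim : IsPrimitive Q) (hdisc : discr Q = D)
    (hA' : 0 < Q'.1) (hprim' : IsPrimitive Q') (hdisc' : discr Q' = D) :
    (minpoly ℚ (formJ Q)).natDegree = (minpoly ℚ (formJ Q')).natDegree := by
  have hSint := isIntegral_rat_of_mem_image_formJ hD
  rw [minpoly_formJ_eq_principalForm hD hSint hA hprim hdisc,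
    minpoly_formJ_eq_principalForm hD hSint hA' hprim' hdisc']

/-- **The field-theoretic core of Cox's degree argument.**  Let `τ₀ ∈ ℍ`, `y = j(τ₀)`, `x = j(τ₀/3)`
be algebraic, `g ∈ ℚ(x)` with `g³ = y`, and suppose every root of `Φ₃(X, y)` is algebraic of the same
degree over `ℚ` as `x`.  Then `y` has a cube root in `ℚ(y)`.  (With `E = ℚ(y) ⊆ F = ℚ(x)`:
`r = [E(x) : E] ≤ 4` as `Φ₃(x, y) = 0`; `r ≠ 3`, else the linear cofactor of `minpoly_E(x)` in
`Φ₃(X, y)` has a root in `E` of degree `deg x` over `ℚ`, forcing `E = ℚ(x)` and `r = 1`; so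
`s = [E(g) : E] ∣ r ∈ {1, 2, 4}` and `s ≤ 3`, whence `s ∈ {1, 2}`: `g ∈ E` or `X³ − y` has a linear
factor over `E`.)  Cox instead bounds `[L′ : L]` by the class number formula (Thm. 7.24) and uses that
`g` is the *real* cube root. [cite: Cox2013, §12.A proof of Thm. 12.2 (p. 261)] -/
theorem exists_mem_adjoin_pow_three_eq {τ₀ : ℍ} {x y g : ℂ} (hy : y = kleinJ τ₀)
    (hx : x = kleinJ (divPoint 3 0 τ₀)) (hxint : IsIntegral ℚ x) (hyint : IsIntegral ℚ y)
    (hg : g ∈ ℚ⟮x⟯) (hg3 : g ^ 3 = y)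
    (hroots : ∀ z : ℂ, ((modularPolynomial 3).map (evalRingHom y)).eval z = 0 →
      IsIntegral ℚ z ∧ (minpoly ℚ z).natDegree = (minpoly ℚ x).natDegree) :
    ∃ e ∈ ℚ⟮y⟯, e ^ 3 = y := by
  set E : IntermediateField ℚ ℂ := ℚ⟮y⟯ with hEdef
  haveI : FiniteDimensional ℚ E := adjoin.finiteDimensional hyint
  haveI : FiniteDimensional ℚ ℚ⟮x⟯ := adjoin.finiteDimensional hxint
  -- `y = g³ ∈ ℚ(x)`, so `E ≤ ℚ(x)`
  have hyF : y ∈ ℚ⟮x⟯ := by rw [← hg3]; exact pow_mem hg 3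
  have hEF : E ≤ ℚ⟮x⟯ := adjoin_simple_le_iff.mpr hyF
  -- `x` over `E`
  have hxE : IsIntegral E x := hxint.tower_top
  haveI : FiniteDimensional E (adjoin E ({x} : Set ℂ)) := adjoin.finiteDimensional hxE
  set r : ℕ := Module.finrank E (adjoin E ({x} : Set ℂ)) with hrdef
  have hr_eq : r = (minpoly E x).natDegree := adjoin.finrank hxE
  -- `Φ₃(X, y)` over `E`
  set y' : E := ⟨y, mem_adjoin_simple_self ℚ y⟩ with hy'
  set P : Polynomial E :=
    ((intModularPolynomial 3).map (mapRingHom (Int.castRingHom E))).map (evalRingHom y') with hP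
  have hPmonic : P.Monic := ((monic_intModularPolynomial 3).map _).map _
  have hPdeg : P.natDegree = 4 := by
    rw [hP, ((monic_intModularPolynomial 3).map _).natDegree_map,
      (monic_intModularPolynomial 3).natDegree_map, natDegree_intModularPolynomial]
  have hPmapC : P.map (algebraMap E ℂ) = (modularPolynomial 3).map (evalRingHom y) := by
    rw [hP, Polynomial.map_map, Polynomial.map_map, ← map_intModularPolynomial (p := 3),
      Polynomial.map_map]
    congr 1
    refine Polynomial.ringHom_ext (fun n ↦ by simp) ?_
    simp [hy']
  have hPx : aeval x P = 0 := by
    rw [aeval_def, eval₂_eq_eval_map, hPmapC, hy, hx]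
    exact modularPolynomial_kleinJ_divPoint 0 τ₀
  have hmin_dvd : minpoly E x ∣ P := minpoly.dvd E x hPx
  have hr4 : r ≤ 4 := by
    rw [hr_eq, ← hPdeg]; exact natDegree_le_of_dvd hmin_dvd hPmonic.ne_zero
  have hr0 : 0 < r := hr_eq ▸ minpoly.natDegree_pos hxE
  -- `r ≠ 3`
  have hr3 : r ≠ 3 := by
    intro h3
    obtain ⟨q, hq⟩ := hmin_dvd
    have hqmonic : q.Monic := (minpoly.monic hxE).of_mul_monic_left (hq ▸ hPmonic)
    have hqdeg : q.natDegree = 1 := by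
      have h := congrArg natDegree hq
      rw [hPdeg, natDegree_mul (minpoly.ne_zero hxE) hqmonic.ne_zero, ← hr_eq, h3] at h
      omega
    have hqe : q = X + C (q.coeff 0) := hqmonic.eq_X_add_C hqdeg
    set e : E := -q.coeff 0 with he
    have hPe : P.eval e = 0 := by
      rw [hq, eval_mul, hqe]; simp [he]
    have hPe' : ((modularPolynomial 3).map (evalRingHom y)).eval (e : ℂ) = 0 := by
      rw [← hPmapC, eval_map, show ((e : E) : ℂ) = algebraMap E ℂ e from rfl, eval₂_at_apply, hPe,
        map_zero]
    obtain ⟨heint, hdeg_e⟩ := hroots _ hPe'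
    -- `ℚ(e) ≤ E ≤ ℚ(x)` with `[ℚ(e) : ℚ] = [ℚ(x) : ℚ]`: so `E = ℚ(x)`
    have h1 : Module.finrank ℚ ℚ⟮(e : ℂ)⟯ ∣ Module.finrank ℚ E :=
      finrank_dvd_of_le_right (adjoin_simple_le_iff.mpr e.2)
    have h2 : Module.finrank ℚ E ∣ Module.finrank ℚ ℚ⟮x⟯ := finrank_dvd_of_le_right hEF
    rw [adjoin.finrank heint, hdeg_e, ← adjoin.finrank hxint] at h1
    have hEeq : E = ℚ⟮x⟯ := eq_of_le_of_finrank_eq hEF (Nat.dvd_antisymm h2 h1)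
    have hxmem : x ∈ E := by rw [hEeq]; exact mem_adjoin_simple_self ℚ x
    have hr1 : r = 1 := by
      rw [hr_eq]
      have hdeg1 : (minpoly E x).degree = 1 :=
        minpoly.degree_eq_one_iff.mpr ⟨⟨x, hxmem⟩, rfl⟩
      exact (degree_eq_iff_natDegree_eq (minpoly.ne_zero hxE)).mp hdeg1
    omega
  -- `g` over `E`: `s = [E(g) : E] ∣ r`, `s ≤ 3`
  have hgint : IsIntegral ℚ g := IsIntegral.of_pow (by norm_num : 0 < 3) (hg3 ▸ hyint)
  have hgE : IsIntegral E g := hgint.tower_top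
  haveI : FiniteDimensional E (adjoin E ({g} : Set ℂ)) := adjoin.finiteDimensional hgE
  have hgEx : g ∈ adjoin E ({x} : Set ℂ) := by
    have hle : ℚ⟮x⟯ ≤ (adjoin E ({x} : Set ℂ)).restrictScalars ℚ :=
      adjoin_simple_le_iff.mpr (subset_adjoin E ({x} : Set ℂ) rfl)
    exact hle hg
  set s : ℕ := Module.finrank E (adjoin E ({g} : Set ℂ)) with hsdef
  have hs_eq : s = (minpoly E g).natDegree := adjoin.finrank hgE
  have hs_dvd : s ∣ r := finrank_dvd_of_le_right (adjoin_simple_le_iff.mpr hgEx)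
  have hcub : minpoly E g ∣ X ^ 3 - C y' := by
    refine minpoly.dvd E g ?_
    simp [hy', hg3]
  have hcubmonic : (X ^ 3 - C y' : Polynomial E).Monic := monic_X_pow_sub_C y' (by norm_num)
  have hcubdeg : (X ^ 3 - C y' : Polynomial E).natDegree = 3 := natDegree_X_pow_sub_C
  have hs3 : s ≤ 3 := by
    rw [hs_eq, ← hcubdeg]; exact natDegree_le_of_dvd hcub hcubmonic.ne_zero
  have hs0 : 0 < s := hs_eq ▸ minpoly.natDegree_pos hgE
  have hs12 : s = 1 ∨ s = 2 := by
    obtain ⟨t, ht⟩ := hs_dvd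
    interval_cases s <;> omega
  rcases hs12 with h1 | h2
  · -- `g ∈ E`
    have hdeg1 : (minpoly E g).degree = 1 := by
      rw [degree_eq_natDegree (minpoly.ne_zero hgE), ← hs_eq, h1]; rfl
    obtain ⟨e, he⟩ := minpoly.degree_eq_one_iff.mp hdeg1
    refine ⟨(e : ℂ), e.2, ?_⟩
    rw [show ((e : E) : ℂ) = algebraMap E ℂ e from rfl, he, hg3]
  · -- `X³ − y = minpoly_E(g) · (X + a)`: the root `−a ∈ E`
    obtain ⟨q, hq⟩ := hcub
    have hqmonic : q.Monic := (minpoly.monic hgE).of_mul_monic_left (hq ▸ hcubmonic)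
    have hqdeg : q.natDegree = 1 := by
      have h := congrArg natDegree hq
      rw [hcubdeg, natDegree_mul (minpoly.ne_zero hgE) hqmonic.ne_zero, ← hs_eq, h2] at h
      omega
    have hqe : q = X + C (q.coeff 0) := hqmonic.eq_X_add_C hqdeg
    set e : E := -q.coeff 0 with he
    have hroot : (X ^ 3 - C y' : Polynomial E).eval e = 0 := by
      rw [hq, eval_mul, hqe]; simp [he]
    have he3 : e ^ 3 = y' := by
      simpa [sub_eq_zero] using hroot
    refine ⟨(e : ℂ), e.2, ?_⟩
    have := congrArg (fun t : E ↦ (t : ℂ)) he3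
    simpa [hy'] using this

end Degrees

/-! ### The roots of `Φ₃(X, j(τ₀))` in the inert case -/

section Roots

variable {b c : ℤ}

/-- **The four roots `j(3τ₀)`, `j((τ₀ + k)/3)` of `Φ₃(X, j(τ₀))` are singular moduli of primitive forms
of discriminant `9D`** when `c ≡ 1 (mod 3)` (`3` inert), `τ₀ = τ_{(1, 3b, c)}`: namely of
`(1, 9b, 9c)` and `(9, 9b − 6k, k² − 3bk + c)`. [cite: Cox2013, §11.B (11.15), §12.A proof of Thm. 12.2] -/
theorem exists_form_of_eval_modularPolynomial_three_eq_zero (hD : 9 * b ^ 2 - 4 * c < 0)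
    (hc : c % 3 = 1) {z : ℂ}
    (hz : ((modularPolynomial 3).map (evalRingHom (kleinJ (heegnerTau ((1 : ℤ), 3 * b, c))))).eval z = 0) :
    ∃ Q : ℤ × ℤ × ℤ, (0 < Q.1 ∧ IsPrimitive Q ∧ discr Q = 9 * (9 * b ^ 2 - 4 * c)) ∧ z = formJ Q := by
  rw [eval_map_kleinJ_modularPolynomial, Finset.prod_eq_zero_iff] at hz
  obtain ⟨i, -, hi⟩ := hz
  rw [sub_eq_zero] at hi
  rcases i with _ | k
  · refine ⟨((1 : ℤ), 9 * b, 9 * c), one_nine_spec b c, ?_⟩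
    rw [hi, jConj_none, mulPoint_three_heegnerTau hD, formJ_eq_kleinJ]
  · refine ⟨((9 : ℤ), 9 * b - 6 * (k.val : ℤ), (k.val : ℤ) ^ 2 - 3 * b * (k.val : ℤ) + c),
      nine_conj_spec hc _, ?_⟩
    rw [hi, jConj_some, divPoint_three_heegnerTau hD, formJ_eq_kleinJ]

/-- Every root of `Φ₃(X, j(τ₀))` is algebraic of the same degree over `ℚ` as `x = j(P₀)`
(inert case). [cite: Cox2013, §12.A proof of Thm. 12.2] -/
theorem roots_modularPolynomial_three_degree (hD : 9 * b ^ 2 - 4 * c < 0) (hc : c % 3 = 1)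
    (z : ℂ)
    (hz : ((modularPolynomial 3).map (evalRingHom (kleinJ (heegnerTau ((1 : ℤ), 3 * b, c))))).eval z = 0) :
    IsIntegral ℚ z ∧ (minpoly ℚ z).natDegree = (minpoly ℚ (formJ ((9 : ℤ), 9 * b, c))).natDegree := by
  obtain ⟨Q, ⟨hA, hprim, hdisc⟩, rfl⟩ := exists_form_of_eval_modularPolynomial_three_eq_zero hD hc hz
  have h9D : 9 * (9 * b ^ 2 - 4 * c) < 0 := by linarith
  obtain ⟨hA', hprim', hdisc'⟩ := nine_spec (b := b) (not_three_dvd_of_emod hc)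
  refine ⟨(isIntegral_int_formJ hA hprim (by rw [hdisc]; exact h9D)).tower_top, ?_⟩
  exact natDegree_minpoly_formJ_eq h9D hA hprim hdisc hA' hprim' hdisc'

end Roots

/-! ### Main theorems -/

section Main

variable {K : Type u} [Field K] [NumberField K]

/-- **`j(τ₀)` has a cube root in `ℚ(j(τ₀))`** for `τ₀ = τ_{(1, 3b, c)}`, `D = 9b² − 4c < 0`,
`c ≡ 1 (mod 3)` (i.e. `D ≡ 2 (mod 3)`, `3` inert) — Cox's Thm. 12.2 in the inert case:
"`ℚ(j(τ₀)) = ℚ(γ₂(τ₀))`". [cite: Cox2013, §12.A Thm. 12.2] -/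
theorem exists_mem_adjoin_formJ_pow_three_eq {b c : ℤ} (hD : 9 * b ^ 2 - 4 * c < 0) (hc : c % 3 = 1) :
    ∃ e ∈ ℚ⟮formJ ((1 : ℤ), 3 * b, c)⟯, e ^ 3 = formJ ((1 : ℤ), 3 * b, c) := by
  have hc3 : ¬ (3 : ℤ) ∣ c := not_three_dvd_of_emod hc
  obtain ⟨hA9, hprim9, hdisc9⟩ := nine_spec (b := b) hc3
  obtain ⟨hA1, hprim1, hdisc1⟩ := one_three_spec b c
  have h9D : 9 * (9 * b ^ 2 - 4 * c) < 0 := by linarith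
  have hyint : IsIntegral ℚ (kleinJ (heegnerTau ((1 : ℤ), 3 * b, c))) := by
    rw [← formJ_eq_kleinJ]
    exact (isIntegral_int_formJ hA1 hprim1 (by rw [hdisc1]; exact hD)).tower_top
  have hxint : IsIntegral ℚ (formJ ((9 : ℤ), 9 * b, c)) :=
    (isIntegral_int_formJ hA9 hprim9 (by rw [hdisc9]; exact h9D)).tower_top
  have hx : formJ ((9 : ℤ), 9 * b, c) = kleinJ (divPoint 3 0 (heegnerTau ((1 : ℤ), 3 * b, c))) := by
    rw [divPoint_three_zero_heegnerTau hD, formJ_eq_kleinJ]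
  have hg3 : weberNineValue (heegnerTau ((9 : ℤ), 9 * b, c)) ^ 3 =
      kleinJ (heegnerTau ((1 : ℤ), 3 * b, c)) := by
    rw [weberNineValue_nine_pow_three hD, formJ_eq_kleinJ]
  rw [formJ_eq_kleinJ ((1 : ℤ), 3 * b, c)]
  exact exists_mem_adjoin_pow_three_eq (τ₀ := heegnerTau ((1 : ℤ), 3 * b, c))
    (x := formJ ((9 : ℤ), 9 * b, c)) (g := weberNineValue (heegnerTau ((9 : ℤ), 9 * b, c)))
    rfl hx hxint hyint (weberNineValue_nine_mem_adjoin hD hc3) hg3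
    (roots_modularPolynomial_three_degree hD hc)

/-- **Cube roots of singular moduli, `3` inert.**  For `K` imaginary quadratic with
`d_K ≡ 2 (mod 3)` and every primitive positive definite form `Q₀` of discriminant `d_K`, the singular
modulus `j(τ_{Q₀})` is the cube of an element of the field of singular moduli
`H_K = singularModuliField K ι ⊂ ℂ`. [cite: Cox2013, §12.A Thm. 12.2] -/
theorem exists_mem_singularModuliField_pow_three_eq_formJ_of_inert (hK : IsImaginaryQuadratic K)
    (h3 : NumberField.discr K % 3 = 2) (ι : K →+* ℂ) {Q₀ : ℤ × ℤ × ℤ} (hA₀ : 0 < Q₀.1)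
    (hprim₀ : IsPrimitive Q₀) (hdisc₀ : discr Q₀ = NumberField.discr K) :
    ∃ w ∈ singularModuliField K ι, w ^ 3 = formJ Q₀ := by
  set D := NumberField.discr K with hDdef
  have hD : D < 0 := hK.discr_neg
  have h4 : D % 4 = 0 ∨ D % 4 = 1 := discr_emod_four hK.1
  -- `τ₀ = τ_{(1, 3b, c)}` with `9b² − 4c = d_K`
  obtain ⟨b, c, hbc⟩ : ∃ b c : ℤ, 9 * b ^ 2 - 4 * c = D := by
    rcases h4 with h | h
    · exact ⟨0, -(D / 4), by omega⟩
    · exact ⟨-1, (9 - D) / 4, by omega⟩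
  have hc : c % 3 = 1 := by omega
  have hD' : 9 * b ^ 2 - 4 * c < 0 := hbc ▸ hD
  obtain ⟨e, he, he3⟩ := exists_mem_adjoin_formJ_pow_three_eq hD' hc
  obtain ⟨hA1, hprim1, hdisc1⟩ := one_three_spec b c
  have hdisc1' : discr ((1 : ℤ), 3 * b, c) = NumberField.discr K := hdisc1.trans hbc
  -- `ℚ(j(τ₀)) ⊆ H_K`
  have hyS : formJ ((1 : ℤ), 3 * b, c) ∈ singularModuliField K ι :=
    formJ_mem_singularModuliField ι hA1 hprim1 hdisc1' hD
  have heS : e ∈ singularModuliField K ι := by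
    have hle : (ℚ⟮formJ ((1 : ℤ), 3 * b, c)⟯).toSubfield ≤ singularModuliField K ι := by
      rw [IntermediateField.adjoin_toSubfield, Subfield.closure_le]
      rintro z (⟨q, rfl⟩ | hz)
      · simp
      · rw [Set.mem_singleton_iff.mp hz]; exact hyS
    exact hle he
  exact exists_mem_pow_three_eq_formJ_of_one hK ι hA1 hprim1 hdisc1' hA₀ hprim₀ hdisc₀ heS he3

/-- **The ideal form, `3` inert**: in `𝓞 H_K`, `(j(τ_{Q₀})) = (w)³` for `d_K ≡ 2 (mod 3)`.
[cite: Cox2013, §12.A Thm. 12.2 (consequence)] -/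
theorem exists_span_formJ_eq_pow_three_of_inert (hK : IsImaginaryQuadratic K)
    (h3 : NumberField.discr K % 3 = 2) (ι : K →+* ℂ) {Q₀ : ℤ × ℤ × ℤ} (hA₀ : 0 < Q₀.1)
    (hprim₀ : IsPrimitive Q₀) (hdisc₀ : discr Q₀ = NumberField.discr K)
    (j₀ : 𝓞 (singularModuliField K ι)) (hj₀ : ((j₀ : singularModuliField K ι) : ℂ) = formJ Q₀) :
    ∃ w : 𝓞 (singularModuliField K ι), Ideal.span {j₀} = Ideal.span {w} ^ 3 := by
  obtain ⟨w, hwmem, hw3⟩ :=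
    exists_mem_singularModuliField_pow_three_eq_formJ_of_inert hK h3 ι hA₀ hprim₀ hdisc₀
  have hD : NumberField.discr K < 0 := hK.discr_neg
  have hjint : IsIntegral ℤ (formJ Q₀) := isIntegral_int_formJ hA₀ hprim₀ (by rw [hdisc₀]; exact hD)
  have hwint : IsIntegral ℤ w := IsIntegral.of_pow (by norm_num : 0 < 3) (by rw [hw3]; exact hjint)
  have hwintF : IsIntegral ℤ (⟨w, hwmem⟩ : singularModuliField K ι) :=
    (isIntegral_algHom_iff (singularModuliField K ι).subtype.toIntAlgHom Subtype.val_injective).mp hwint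
  have hjF : (j₀ : singularModuliField K ι) = (⟨w, hwmem⟩ : singularModuliField K ι) ^ 3 := by
    apply Subtype.ext
    rw [SubmonoidClass.coe_pow, hw3]
    exact hj₀
  have hj : j₀ = ⟨⟨w, hwmem⟩, hwintF⟩ ^ 3 := by
    apply NumberField.RingOfIntegers.ext
    rw [hjF, RingOfIntegers.coe_eq_algebraMap, map_pow, RingOfIntegers.map_mk]
  exact ⟨⟨⟨w, hwmem⟩, hwintF⟩, by rw [hj, Ideal.span_singleton_pow]⟩

/-- **Cox's Thm. 12.2, cube part, maximal order, `3 ∤ d_K`**: for `K` imaginary quadratic with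
`3 ∤ d_K`, every singular modulus of discriminant `d_K` generates, in the ring of integers of the field
of singular moduli `H_K`, the cube of a principal ideal — the split case
(`exists_span_formJ_eq_pow_three`, level-`9` Heegner points) and the inert case
(`exists_span_formJ_eq_pow_three_of_inert`, the point `τ₀/3`) combined.
[cite: Cox2013, §12.A Thm. 12.2] -/
theorem exists_span_formJ_eq_pow_three_of_not_dvd (hK : IsImaginaryQuadratic K)
    (h3 : ¬ (3 : ℤ) ∣ NumberField.discr K) (ι : K →+* ℂ) {Q₀ : ℤ × ℤ × ℤ} (hA₀ : 0 < Q₀.1)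
    (hprim₀ : IsPrimitive Q₀) (hdisc₀ : discr Q₀ = NumberField.discr K)
    (j₀ : 𝓞 (singularModuliField K ι)) (hj₀ : ((j₀ : singularModuliField K ι) : ℂ) = formJ Q₀) :
    ∃ w : 𝓞 (singularModuliField K ι), Ideal.span {j₀} = Ideal.span {w} ^ 3 := by
  have h12 : NumberField.discr K % 3 = 1 ∨ NumberField.discr K % 3 = 2 := by omega
  rcases h12 with h | h
  · exact exists_span_formJ_eq_pow_three hK h ι hA₀ hprim₀ hdisc₀ j₀ hj₀
  · exact exists_span_formJ_eq_pow_three_of_inert hK h ι hA₀ hprim₀ hdisc₀ j₀ hj₀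

end Main

end Literature.NumberTheory.EllipticCurves

end
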